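import Literature.Analysis.SingularIntegrals.SteinPowerWeights
import Literature.Analysis.FluidPDE.NormalisedPressureWeightedLp
import Literature.Analysis.FluidPDE.NormalisedPressurePowerWeightBound
import HarnessLib

/-!
# The power-weighted `L^p` bound for the normalised pressure: discharge of `grafakos2014_normalisedPressure_powerWeight_bound`

Analysis/FluidPDE proofs file; sibling of `NormalisedPressurePowerWeightBound` (the named fact
`Literature.Analysis.FluidPDE.grafakos2014_normalisedPressure_powerWeight_bound`: for
`1 < p < ∞`, `-3 < β < 3(p-1)` there is `C` with `‖p̃[w]‖_{L^p(|x|^β dx)} ≤ C ‖|w|²‖_{L^p(|x|^β dx)}`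
for all test fields `w`; Grafakos 2014, Thm 7.4.6 with Ex. 7.1.7 — for power weights this is
E. M. Stein, *Note on singular integrals*, Proc. AMS 8 (1957), Theorem), which is the last
unproved input of `Literature.Analysis.FluidPDE.tsai1998_weightedRieszPressure` (Tsai 1998, §4
p. 45, `p = 5/3`, `β = -5/3`; reduced to the fact in `FluidPDE/TsaiWeightedRieszPressureProofs`).
**This file PROVES the fact** (`grafakos2014_normalisedPressure_powerWeight_bound_holds`) from
the tree's proved singular-integral theory:

* §1 the unweighted Calderón–Zygmund bound for the regularised Hessian convolutions
  `H^a_ε[f] = ∫ f(t) ∂ₐ∂ₐΦ_ε(· - t) dt` on bounded compactly supported measurable `f`, uniformly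
  in `ε > 0` and `|a| ≤ 2` (`exists_eLpNorm_hessConv_le_of_bdd`: the uniform theorem
  `SingularIntegrals.exists_eLpNorm_le` with the `L²` bound `eLpNorm_hessConv_le` and the
  Hörmander bound `exists_hormander_bound_hessKernel`, exactly as in
  `NormalisedPressureLpBoundProofs.exists_eLpNorm_hessConv_le` but on the admissible class that
  Stein's theorem consumes);
* §2 **Stein's power-weight theorem** (`SingularIntegrals.stein1957_powerWeight`, Stein 1957)
  for the kernels `k^a_ε`, whose size condition `|k^a_ε(z)| ≤ A|a|²/|z|³` holds uniformly in the
  scale (`exists_bound_abs_hessKernel_le`, `NormalisedPressureWeightedLp`): with `α = β/p`,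
  `-3/p < α < 3/p'` iff `-3 < β < 3(p-1)`, so `‖|x|^α H^a_ε[h]‖_p ≤ C ‖|x|^α h‖_p`, i.e.
  (§2, `eLpNorm_withDensity_normRpow_eq`: `‖f‖_{L^p(|x|^β)} = ‖|x|^{β/p} f‖_{L^p}`)
  `‖H^a_ε[h]‖_{L^p(|x|^β)} ≤ C ‖h‖_{L^p(|x|^β)}` for `h ∈ C_c`, uniformly in `ε`, `|a| ≤ 2`
  (`exists_eLpNorm_hessConv_withDensity_le`);
* §3 polarisation and Fatou in `L^p(|x|^β dx)` (`eLpNorm_normalisedPressure_le_of_hessConv`,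
  `NormalisedPressureWeightedLp`): the fact, with constant `27 C`.

## References

* E. M. Stein, *Note on singular integrals*, Proc. Amer. Math. Soc. 8 (1957) 250–254, Theorem
  (p. 250) and §3 [Stein1957].
* L. Grafakos, *Classical Fourier Analysis*, 3rd ed. (2014), Thm 7.4.6, Example 7.1.7
  [Grafakos2014].
* E. M. Stein, *Singular integrals and differentiability properties of functions* (1970),
  Ch. II §4.2 Thm 3 [Stein1971].
* T.-P. Tsai, *On Leray's self-similar solutions of the Navier–Stokes equations satisfying local
  energy estimates*, Arch. Rational Mech. Anal. 143 (1998), §4 pp. 45–46 [Tsai1998].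
-/

noncomputable section

open MeasureTheory Set Filter Topology Function Metric
open scoped ENNReal NNReal RealInnerProductSpace ContDiff

namespace Literature.Analysis.FluidPDE

/-! ## §1. The unweighted bound on the admissible class, uniformly in the scale -/

section Unweighted

/-- **Unweighted `L^p` bound for the regularised Hessian convolutions on bounded compactly
supported measurable functions, uniform in the scale** (Stein 1970, Ch. II §4.2 Theorem 3 for
the kernels `k^a_ε = ∂ₐ∂ₐΦ_ε`, via the uniform Calderón–Zygmund theorem
`SingularIntegrals.exists_eLpNorm_le`): for `1 < p < ∞` there is `C` with
`‖∫ f(t) k^a_ε(· - t) dt‖_p ≤ C ‖f‖_p` for all `ε > 0`, `|a| ≤ 2` and all bounded compactly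
supported measurable `f` (the class on which Stein's power-weight theorem is stated; the
continuous compactly supported case is `exists_eLpNorm_hessConv_le`). [cite: Stein1971, Ch. II §4.2 Thm 3] -/
theorem exists_eLpNorm_hessConv_le_of_bdd {p : ℝ≥0∞} (hp1 : 1 < p) (hp2 : p < ⊤) :
    ∃ C : ℝ≥0, ∀ ε : ℝ, 0 < ε → ∀ a : (EuclideanSpace ℝ (Fin 3)), ‖a‖ ≤ 2 →
      ∀ f : (EuclideanSpace ℝ (Fin 3)) → ℝ, Measurable f → (∃ C' : ℝ, ∀ x, |f x| ≤ C') →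
        HasCompactSupport f →
        eLpNorm (fun x => ∫ t, f t * fderiv ℝ (fun s => fderiv ℝ (newtonReg ε) s a) (x - t) a)
          p volume ≤ C * eLpNorm f p volume := by
  obtain ⟨M, hM0, hM⟩ := exists_bound_fderiv_fderiv_newtonReg
  obtain ⟨B, hB⟩ := exists_hormander_bound_hessKernel
  set A₀ : ℝ≥0 := (4 * regLaplacianMass).toNNReal with hA₀
  obtain ⟨C, hC⟩ := SingularIntegrals.exists_eLpNorm_le.{0} 3 A₀ B hp1 hp2
  refine ⟨C, fun ε hε a ha f hf hfb hfc => ?_⟩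
  have ha2 : ‖a‖ ^ 2 ≤ 4 := by nlinarith [norm_nonneg a]
  -- the kernel `k^a_ε`, its measurability and sup bound
  have hkm : Measurable fun z : (EuclideanSpace ℝ (Fin 3)) =>
      fderiv ℝ (fun s => fderiv ℝ (newtonReg ε) s a) z a :=
    (continuous_hessKernel ε a).measurable
  have hkb : ∃ M' : ℝ, ∀ z : (EuclideanSpace ℝ (Fin 3)),
      |fderiv ℝ (fun s => fderiv ℝ (newtonReg ε) s a) z a| ≤ M' :=
    ⟨ε⁻¹ ^ 3 * M * ‖a‖ ^ 2, fun z => abs_hessKernel_le hM hε a z⟩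
  -- the `L²` bound on continuous compactly supported functions
  have hL2 : ∀ g : (EuclideanSpace ℝ (Fin 3)) → ℝ, Continuous g → HasCompactSupport g →
      eLpNorm (fun x => ∫ t, g t * fderiv ℝ (fun s => fderiv ℝ (newtonReg ε) s a) (x - t) a)
        2 volume ≤ A₀ * eLpNorm g 2 volume := by
    intro g hg hgc
    have hA₀' : (A₀ : ℝ≥0∞) = ENNReal.ofReal (4 * regLaplacianMass) := rfl
    calc eLpNorm (fun x => ∫ t, g t * fderiv ℝ (fun s => fderiv ℝ (newtonReg ε) s a) (x - t) a)
          2 volume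
        = eLpNorm (hessConv ε g a) 2 volume := rfl
      _ ≤ ENNReal.ofReal (‖a‖ ^ 2) * (ENNReal.ofReal regLaplacianMass * eLpNorm g 2 volume) :=
          eLpNorm_hessConv_le hε hg hgc a
      _ = ENNReal.ofReal (‖a‖ ^ 2 * regLaplacianMass) * eLpNorm g 2 volume := by
          rw [ENNReal.ofReal_mul (by positivity), mul_assoc]
      _ ≤ A₀ * eLpNorm g 2 volume := by
          rw [hA₀']
          gcongr
          exact regLaplacianMass_nonneg
  exact hC (E := (EuclideanSpace ℝ (Fin 3))) volume finrank_euclideanSpace_fin hkm hkb hL2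
    (hB ε hε a ha) f hf hfb hfc

end Unweighted

/-! ## §2. Stein's theorem for the regularised kernels: the weighted bound on `H^a_ε` -/

section Weighted

/-- Off the origin the power weight is the real power: `‖x‖ₑ^β = ofReal(|x|^β)`. [folklore] -/
theorem enorm_rpow_eq_ofReal_normRpow {x : (EuclideanSpace ℝ (Fin 3))} (hx : x ≠ 0) (β : ℝ) :
    ‖x‖ₑ ^ β = ENNReal.ofReal (‖x‖ ^ β) := by
  rw [← ofReal_norm, ENNReal.ofReal_rpow_of_pos (norm_pos_iff.2 hx)]

/-- **`L^p(|x|^β dx)` norms as `L^p` norms of `|x|^{β/p} f`**: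
`‖f‖_{L^p(|x|^β dx)} = ‖|x|^{β/p} f‖_{L^p(dx)}` for real `p > 0` and real-valued `f` (the
passage between the weighted-measure form of Grafakos/Tsai and the multiplier form of Stein
1957). [folklore] -/
theorem eLpNorm_withDensity_normRpow_eq {p : ℝ} (hp : 0 < p) (β : ℝ)
    (f : (EuclideanSpace ℝ (Fin 3)) → ℝ) :
    eLpNorm f (ENNReal.ofReal p)
        ((volume : Measure (EuclideanSpace ℝ (Fin 3))).withDensity fun x => ‖x‖ₑ ^ β) =
      eLpNorm (fun x => ‖x‖ ^ (β / p) * f x) (ENNReal.ofReal p) volume := by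
  have hp0 : ENNReal.ofReal p ≠ 0 := (ENNReal.ofReal_pos.2 hp).ne'
  have hptop : ENNReal.ofReal p ≠ ⊤ := ENNReal.ofReal_ne_top
  have htoReal : (ENNReal.ofReal p).toReal = p := ENNReal.toReal_ofReal hp.le
  have hae : ∀ᵐ x ∂(volume : Measure (EuclideanSpace ℝ (Fin 3))), x ≠ 0 :=
    SingularIntegrals.ae_ne_zero
  rw [eLpNorm_eq_lintegral_rpow_enorm_toReal hp0 hptop,
    eLpNorm_eq_lintegral_rpow_enorm_toReal hp0 hptop, htoReal]
  congr 1
  rw [lintegral_withDensity_eq_lintegral_mul_non_measurable _ (measurable_enorm.pow_const β)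
    (by filter_upwards [hae] with x hx
        rw [enorm_rpow_eq_ofReal_normRpow hx]
        exact ENNReal.ofReal_lt_top)]
  refine lintegral_congr_ae ?_
  filter_upwards [hae] with x hx
  have hxpos : 0 < ‖x‖ := norm_pos_iff.2 hx
  simp only [Pi.mul_apply]
  rw [enorm_mul, ENNReal.mul_rpow_of_nonneg _ _ hp.le,
    Real.enorm_eq_ofReal (Real.rpow_nonneg (norm_nonneg _) _),
    ENNReal.ofReal_rpow_of_nonneg (Real.rpow_nonneg (norm_nonneg _) _) hp.le,
    ← Real.rpow_mul (norm_nonneg _), div_mul_cancel₀ β hp.ne', enorm_rpow_eq_ofReal_normRpow hx]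

/-- **Stein's power-weight theorem for the regularised Hessian convolutions** (Stein 1957,
Theorem, applied to the kernels `k^a_ε = ∂ₐ∂ₐΦ_ε` with `|k^a_ε(z)| ≤ 4A/|z|³` for `|a| ≤ 2`,
uniformly in `ε`): for real `1 < p < ∞` with conjugate `q` and `-3 < β < 3(p-1)` (i.e.
`-3/p < β/p < 3/q`) there is `C < ∞` with
`‖H^a_ε[h]‖_{L^p(|x|^β dx)} ≤ C ‖h‖_{L^p(|x|^β dx)}` for all `ε > 0`, `|a| ≤ 2` and
`h ∈ C_c(ℝ³)`. [cite: Stein1957, Theorem (p. 250) and §3] -/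
theorem exists_eLpNorm_hessConv_withDensity_le {p q : ℝ} (hpq : p.HolderConjugate q) {β : ℝ}
    (hβ1 : -3 < β) (hβ2 : β < 3 * (p - 1)) :
    ∃ C : ℝ≥0, ∀ ε : ℝ, 0 < ε → ∀ a : (EuclideanSpace ℝ (Fin 3)), ‖a‖ ≤ 2 →
      ∀ h : (EuclideanSpace ℝ (Fin 3)) → ℝ, Continuous h → HasCompactSupport h →
        eLpNorm (hessConv ε h a) (ENNReal.ofReal p)
            ((volume : Measure (EuclideanSpace ℝ (Fin 3))).withDensity fun x => ‖x‖ₑ ^ β) ≤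
          C * eLpNorm h (ENNReal.ofReal p)
            ((volume : Measure (EuclideanSpace ℝ (Fin 3))).withDensity fun x => ‖x‖ₑ ^ β) := by
  have hp : 0 < p := hpq.pos
  have hp1 : 1 < p := hpq.lt
  have hq : 0 < q := hpq.symm.pos
  -- the exponent `α = β / p` of the multiplier form
  set α : ℝ := β / p with hα
  have hα1 : -(3 / p) < α := by
    rw [hα, show -(3 / p) = (-3) / p by ring]
    exact div_lt_div_of_pos_right hβ1 hp
  have hα2 : α < 3 / q := by
    have hpne : p ≠ 0 := hp.ne'
    have hq' : 3 / q = 3 * (p - 1) / p := by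
      have hinv : q⁻¹ = 1 - p⁻¹ := by linarith [hpq.inv_add_inv_eq_one]
      rw [div_eq_mul_inv, hinv]
      field_simp
    rw [hα, hq']
    exact div_lt_div_of_pos_right hβ2 hp
  -- the three constants: Stein's, the kernel size, the unweighted Calderón–Zygmund bound
  obtain ⟨CS, hCS⟩ := SingularIntegrals.stein1957_powerWeight hpq hα1 hα2
  obtain ⟨A₀, hA₀0, hA₀⟩ := exists_bound_abs_hessKernel_le
  obtain ⟨M, hM0, hM⟩ := exists_bound_fderiv_fderiv_newtonReg
  have hp1' : (1 : ℝ≥0∞) < ENNReal.ofReal p := by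
    rw [← ENNReal.ofReal_one]
    exact (ENNReal.ofReal_lt_ofReal_iff hp).2 hp1
  obtain ⟨Cp, hCp⟩ := exists_eLpNorm_hessConv_le_of_bdd hp1' ENNReal.ofReal_lt_top
  set A : ℝ≥0 := (4 * A₀).toNNReal with hA_def
  refine ⟨Cp + A * CS, fun ε hε a ha h hh hhc => ?_⟩
  have ha2 : ‖a‖ ^ 2 ≤ 4 := by nlinarith [norm_nonneg a]
  -- hypotheses of Stein's theorem for the kernel `k^a_ε`
  have hkm : Measurable fun z : (EuclideanSpace ℝ (Fin 3)) =>
      fderiv ℝ (fun s => fderiv ℝ (newtonReg ε) s a) z a :=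
    (continuous_hessKernel ε a).measurable
  have hkM : ∀ z : (EuclideanSpace ℝ (Fin 3)),
      |fderiv ℝ (fun s => fderiv ℝ (newtonReg ε) s a) z a| ≤ ε⁻¹ ^ 3 * M * ‖a‖ ^ 2 :=
    fun z => abs_hessKernel_le hM hε a z
  have hkA : ∀ z : (EuclideanSpace ℝ (Fin 3)), z ≠ 0 →
      |fderiv ℝ (fun s => fderiv ℝ (newtonReg ε) s a) z a| ≤ A * (‖z‖ ^ 3)⁻¹ := by
    intro z hz
    have hz' : 0 < ‖z‖ := norm_pos_iff.2 hz
    have hAcoe : ((A : ℝ≥0) : ℝ) = 4 * A₀ := by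
      rw [hA_def, Real.coe_toNNReal _ (by positivity)]
    calc |fderiv ℝ (fun s => fderiv ℝ (newtonReg ε) s a) z a| ≤ A₀ * ‖a‖ ^ 2 / ‖z‖ ^ 3 :=
          hA₀ ε hε a z hz
      _ ≤ A₀ * 4 / ‖z‖ ^ 3 := by gcongr
      _ = A * (‖z‖ ^ 3)⁻¹ := by rw [hAcoe, div_eq_mul_inv]; ring
  have hCp' : ∀ f : (EuclideanSpace ℝ (Fin 3)) → ℝ, Measurable f → (∃ C', ∀ x, |f x| ≤ C') →
      HasCompactSupport f →
      eLpNorm (fun x => ∫ t, f t * fderiv ℝ (fun s => fderiv ℝ (newtonReg ε) s a) (x - t) a)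
        (ENNReal.ofReal p) volume ≤ (Cp : ℝ≥0∞) * eLpNorm f (ENNReal.ofReal p) volume :=
    fun f hf hfb hfc => hCp ε hε a ha f hf hfb hfc
  -- `h` is in the admissible class
  have hhb : ∃ C' : ℝ, ∀ x, |h x| ≤ C' := by
    obtain ⟨C', hC'⟩ := hh.bounded_above_of_compact_support hhc
    exact ⟨C', fun x => by rw [← Real.norm_eq_abs]; exact hC' x⟩
  have hSt := hCS hkm hkM hkA hCp' h hh.measurable hhb hhc
  -- translate the multiplier form into the weighted-measure form
  rw [eLpNorm_withDensity_normRpow_eq hp β, eLpNorm_withDensity_normRpow_eq hp β]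
  calc eLpNorm (fun x => ‖x‖ ^ (β / p) * hessConv ε h a x) (ENNReal.ofReal p) volume
      = eLpNorm (fun x => ‖x‖ ^ α *
          ∫ t, h t * fderiv ℝ (fun s => fderiv ℝ (newtonReg ε) s a) (x - t) a)
          (ENNReal.ofReal p) volume := rfl
    _ ≤ (Cp + A * CS) * eLpNorm (fun x => ‖x‖ ^ α * h x) (ENNReal.ofReal p) volume := hSt
    _ = ((Cp + A * CS : ℝ≥0) : ℝ≥0∞) * eLpNorm (fun x => ‖x‖ ^ (β / p) * h x)
          (ENNReal.ofReal p) volume := by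
        push_cast
        rfl

end Weighted

/-! ## §3. The discharge -/

section Discharge

/-- **Discharge of `grafakos2014_normalisedPressure_powerWeight_bound`** (Grafakos 2014,
Thm 7.4.6 with Example 7.1.7, for the Riesz-type operator of the normalised pressure; proved
here by E. M. Stein's 1957 power-weight theorem on top of the tree's Calderón–Zygmund theory):
for `1 < p < ∞` and `-3 < β < 3(p-1)` there is `C` with
`‖p̃[w]‖_{L^p(|x|^β dx)} ≤ C ‖|w|²‖_{L^p(|x|^β dx)}` for every `w ∈ C_c^∞(ℝ³; ℝ³)` (§2 for the
27 Hessian convolutions, then polarisation and Fatou in `L^p(|x|^β dx)`,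
`eLpNorm_normalisedPressure_le_of_hessConv`). Tsai 1998 (§4 p. 45) is the case `p = 5/3`,
`β = -5/3`. [cite: Grafakos2014, Thm 7.4.6 and Example 7.1.7] -/
theorem grafakos2014_normalisedPressure_powerWeight_bound_holds :
    grafakos2014_normalisedPressure_powerWeight_bound := by
  intro p hp1 hp2 β hβ1 hβ2
  -- the real exponent
  set pr : ℝ := p.toReal with hpr
  have hptop : p ≠ ⊤ := hp2.ne
  have hpeq : ENNReal.ofReal pr = p := ENNReal.ofReal_toReal hptop
  have hpr1 : 1 < pr := by
    rw [hpr, ← ENNReal.toReal_one]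
    exact (ENNReal.toReal_lt_toReal ENNReal.one_ne_top hptop).2 hp1
  have hpq : pr.HolderConjugate (Real.conjExponent pr) := Real.HolderConjugate.conjExponent hpr1
  obtain ⟨C, hC⟩ := exists_eLpNorm_hessConv_withDensity_le hpq hβ1 hβ2
  refine ⟨27 * C, fun w hw hwc => ?_⟩
  rw [← hpeq]
  have h := eLpNorm_normalisedPressure_le_of_hessConv
    (μ := (volume : Measure (EuclideanSpace ℝ (Fin 3))).withDensity fun x => ‖x‖ₑ ^ β)
    (p := ENNReal.ofReal pr) (by rw [hpeq]; exact hp1.le) (C := (C : ℝ≥0∞))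
    (fun ε hε a ha h hh hhc => hC ε hε a ha h hh hhc) hw hwc
  simpa only [ENNReal.coe_mul, ENNReal.coe_ofNat] using h

end Discharge

end Literature.Analysis.FluidPDE

end
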